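import Literature.Computability.AlgebraicComplexity.GraphTensor
import HarnessLib

/-!
# Flattenings of graph tensors along a vertex cut: `R(T_n(G)) ≥ n^{e(S, V∖S)}`, `ω(T(G)) ≥` size of a cut,
# and the even cycles `ω(T(C_{2m})) = 2m` (Christandl–Vrana–Zuiddam 2019, Prop. 1.1.20, Ex. 1.1.21, Thm. 1.1.24)

Topic `Literature/Computability/AlgebraicComplexity`, sequel of `GraphTensor.lean` (`graphTensor`, `graphExponents`,
`graphOmega`, `cycleSlots`, `tetraSlots`, the named fact `cvz19_thm_1_1_24`).  Everything here is PROVED (no named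
fact); the even-cycle clause of the named fact `cvz19_thm_1_1_24` becomes a theorem (`graphOmega_cycleSlots_of_even`).

## What is printed

[CVZ19] Christandl–Vrana–Zuiddam, arXiv:1609.07476: Def. 1.1.19 (p. 6) "A flattening of `φ` is a 2-tensor (a
matrix) obtained by any grouping of the tensor legs `U_1, …, U_k` into two groups."; Prop. 1.1.20 "Let `φ` be a
`k`-tensor and let `A_φ` be any flattening of `φ`. Then `R(A_φ) ≤ R(φ)` … A flattening of a simple `k`-tensor is a
simple 2-tensor (a rank-1 matrix)"; Ex. 1.1.21 "A cut of a graph `G = (V,E)` is a partition of `V` into two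
disjoint nonempty sets. … For any graph `G`, let `f(G)` denote the size of a max-cut of `G` … Flattening along the
appropriate cuts yields `… 2^{f(G)} ≤ R(T(G))` and thus `… f(G) ≤ ω(T(G))`. … let `φ = T(C_k)`. Then … `f(C_k) =
k − 1`" [for odd `k`; for even `k` every edge crosses the alternating cut]; Thm. 1.1.24 "`ω(T(C_k)) = k` when `k`
is even"; §1.2 table: "`4 ≤ ω(T(K_4))`" (flattening along a max-cut, `f(K_4) = 4`).

## What is typed (all PROVED)

* `cutSlice c T r` — the slice of a `k`-tensor `T : (Fin k → Fin N) → F` at the row index `r` on the legs `v`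
  with `c v = true` (a vector on the multi-indices of the legs with `c v = false`): the rows of the flattening
  `A_T` along the cut `c : Fin k → Bool` (Def. 1.1.19); **`card_le_tensorRankD_of_linearIndependent_cutSlice`**:
  a linearly independent family of rows of the flattening has at most `R(T)` members (Prop. 1.1.20: every row of
  a simple tensor's flattening is a multiple of one vector, so the rows of `A_T` span a space of dimension
  `≤ R(T)`).
* For a graph tensor with no empty edge and a vertex cut `c`: the edges `e` CROSSING the cut (read by a vertex
  on each side) and **`pow_card_crossing_le_tensorRankD_graphTensor`:
  `n ^ #{e crossing} ≤ R(T_n(G))`** (`n ≥ 1`; the rows indexed by the labellings of the crossing edges are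
  linearly independent — Ex. 1.1.21's `2^{f(G)} ≤ R(T(G))` at level `n`), hence
  **`card_crossing_le_graphOmega`: `#{e crossing} ≤ ω(T(G))`** (`f(G) ≤ ω(T(G))` for the chosen cut).
* Cycles: along the parity cut every edge of `C_k`, `k` even, crosses ⇒ **`graphOmega_cycleSlots_of_even :
  ω(T(C_k)) = k`** (Thm. 1.1.24, even case, over every field); the tetrahedron: the cut `{0,1} | {2,3}` has `4`
  crossing edges ⇒ **`four_le_graphOmega_tetraSlots : 4 ≤ ω(T(K_4))`** (§1.2 table; the Summit proves the same
  for its `tetra` as `four_le_omegaTetra`).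

No `sorry`, no axiom, no instance, no notation, no `Prop`-valued definition (the crossing condition is a `Bool`).

## References

* [CVZ19] Christandl–Vrana–Zuiddam, arXiv:1609.07476, Def. 1.1.19, Prop. 1.1.20, Ex. 1.1.21, Thm. 1.1.24, §1.2
  (table).  [ChristandlVranaZuiddam2016]
-/

noncomputable section

open scoped BigOperators
open Filter Asymptotics Module

namespace Literature.Computability.AlgebraicComplexity

/-! ## §1. Rows of a flattening and the bound `#(independent rows) ≤ R(T)` (CVZ19 Prop. 1.1.20) -/

section Flattening

variable {F : Type*} [Field F] {k N : ℕ}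

/-- Merge a row index (legs with `c v = true`) and a column index (legs with `c v = false`) of the flattening
along the cut `c` into a multi-index. [cite: ChristandlVranaZuiddam2016, Def. 1.1.19] -/
def cutMerge (c : Fin k → Bool) (r : {v : Fin k // c v = true} → Fin N) (s : {v : Fin k // c v = false} → Fin N) :
    Fin k → Fin N :=
  fun v => if h : c v = true then r ⟨v, h⟩ else s ⟨v, Bool.eq_false_iff.mpr h⟩

/-- The row of the flattening `A_T` of `T` along the cut `c` at the row index `r`: the vector
`s ↦ T(merge r s)` on the column indices. [cite: ChristandlVranaZuiddam2016, Def. 1.1.19] -/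
def cutSlice (c : Fin k → Bool) (T : (Fin k → Fin N) → F) (r : {v : Fin k // c v = true} → Fin N) :
    ({v : Fin k // c v = false} → Fin N) → F :=
  fun s => T (cutMerge c r s)

/-- `cutMerge` on a `true` leg reads the row index. [cite: ChristandlVranaZuiddam2016, Def. 1.1.19] -/
theorem cutMerge_of_true (c : Fin k → Bool) (r : {v : Fin k // c v = true} → Fin N)
    (s : {v : Fin k // c v = false} → Fin N) (v : Fin k) (h : c v = true) : cutMerge c r s v = r ⟨v, h⟩ := by
  simp [cutMerge, h]

/-- `cutMerge` on a `false` leg reads the column index. [cite: ChristandlVranaZuiddam2016, Def. 1.1.19] -/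
theorem cutMerge_of_false (c : Fin k → Bool) (r : {v : Fin k // c v = true} → Fin N)
    (s : {v : Fin k // c v = false} → Fin N) (v : Fin k) (h : c v = false) : cutMerge c r s v = s ⟨v, h⟩ := by
  simp [cutMerge, h]

/-- The row of the flattening of a SIMPLE tensor `⊗_v u_v` at `r` is the multiple
`(∏_{c v} u_v(r_v)) · (s ↦ ∏_{¬ c v} u_v(s_v))` of one fixed vector (CVZ19, proof of Prop. 1.1.20: "A flattening
of a simple `k`-tensor is a simple 2-tensor"). [cite: ChristandlVranaZuiddam2016, Prop. 1.1.20] -/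
theorem cutSlice_rankOneTensor (c : Fin k → Bool) (u : Fin k → Fin N → F) (r : {v : Fin k // c v = true} → Fin N) :
    cutSlice c (rankOneTensor u) r =
      (∏ v : {v : Fin k // c v = true}, u v.1 (r v)) •
        fun s => ∏ v : {v : Fin k // c v = false}, u v.1 (s v) := by
  classical
  funext s
  simp only [cutSlice, rankOneTensor_apply, Pi.smul_apply, smul_eq_mul]
  rw [← Fintype.prod_subtype_mul_prod_subtype (fun v => c v = true) (fun v => u v (cutMerge c r s v))]
  congr 1
  · exact Finset.prod_congr rfl fun v _ => by rw [cutMerge_of_true c r s v.1 v.2]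
  · refine Fintype.prod_equiv (Equiv.subtypeEquivRight fun v => by simp) _ _ fun v => ?_
    rw [cutMerge_of_false c r s v.1 (Bool.eq_false_iff.mpr v.2)]
    rfl

/-- **CVZ19 Prop. 1.1.20 (rows of a flattening).** If a family of rows of the flattening of `T` along a cut is
linearly independent, it has at most `R(T)` members: a decomposition `T = ∑_{l<r} ⊗_v u_{l,v}` puts every row
in the span of the `r` vectors `s ↦ ∏_{¬ c v} u_{l,v}(s_v)` (so `rank A_T ≤ R(T)`).
[cite: ChristandlVranaZuiddam2016, Prop. 1.1.20] -/
theorem card_le_tensorRankD_of_linearIndependent_cutSlice (c : Fin k → Bool) (T : (Fin k → Fin N) → F)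
    (hT : ∃ s : ℕ, ∃ g : Fin s → ((Fin k → Fin N) → F), (∀ t, g t ∈ rankOneTensors F N k) ∧ ∑ t, g t = T)
    {ι : Type*} [Fintype ι] (r : ι → {v : Fin k // c v = true} → Fin N)
    (h : LinearIndependent F fun i => cutSlice c T (r i)) : Fintype.card ι ≤ tensorRankD T := by
  classical
  obtain ⟨g, hg, hsum⟩ := sComplexity_spec hT
  simp only [rankOneTensors, Set.mem_range] at hg
  choose u hu using hg
  let M : Fin (tensorRankD T) → ({v : Fin k // c v = false} → Fin N) → F :=
    fun l s => ∏ v : {v : Fin k // c v = false}, u l v.1 (s v)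
  let W : Submodule F (({v : Fin k // c v = false} → Fin N) → F) := Submodule.span F (Set.range M)
  have hmem : ∀ i, cutSlice c T (r i) ∈ W := by
    intro i
    have hslice : cutSlice c T (r i) =
        ∑ l, (∏ v : {v : Fin k // c v = true}, u l v.1 (r i v)) • M l := by
      funext s
      simp only [cutSlice]
      rw [show T (cutMerge c (r i) s) = ∑ l, g l (cutMerge c (r i) s) from
          (congrFun hsum.symm _).trans (Finset.sum_apply _ _ _), Finset.sum_apply]
      refine Finset.sum_congr rfl fun l _ => ?_
      rw [← hu l]
      exact congrFun (cutSlice_rankOneTensor c (u l) (r i)) s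
    rw [hslice]
    exact W.sum_mem fun l _ => W.smul_mem _ (Submodule.subset_span ⟨l, rfl⟩)
  have h' : LinearIndependent F (fun i => (⟨cutSlice c T (r i), hmem i⟩ : W)) :=
    LinearIndependent.of_comp W.subtype h
  calc Fintype.card ι ≤ finrank F W := h'.fintype_card_le_finrank
    _ ≤ Fintype.card (Fin (tensorRankD T)) := finrank_range_le_card M
    _ = tensorRankD T := Fintype.card_fin _

end Flattening

/-! ## §2. Graph tensors: the rows indexed by the labellings of the crossing edges are independent
(CVZ19 Ex. 1.1.21) -/

section Cut

variable {F : Type*} [Field F] {k D : ℕ} {E : Type*} [Fintype E] [DecidableEq E]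

/-- An edge CROSSES the vertex cut `c` when it is read by a vertex on each side (a Boolean test).
[cite: ChristandlVranaZuiddam2016, Ex. 1.1.21] -/
def crosses (σ : Fin k → Fin D → E) (c : Fin k → Bool) (e : E) : Bool :=
  decide ((∃ v j, c v = true ∧ σ v j = e) ∧ (∃ w j, c w = false ∧ σ w j = e))

omit [Fintype E] in
/-- Unfolding the crossing test. [cite: ChristandlVranaZuiddam2016, Ex. 1.1.21] -/
theorem crosses_iff (σ : Fin k → Fin D → E) (c : Fin k → Bool) (e : E) :
    crosses σ c e = true ↔ (∃ v j, c v = true ∧ σ v j = e) ∧ (∃ w j, c w = false ∧ σ w j = e) := by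
  simp [crosses]

/-- The labelling extending `m` (on the crossing edges) by the label `0` elsewhere (`n ≥ 1`).
[cite: ChristandlVranaZuiddam2016, Ex. 1.1.21] -/
def extendLabel (σ : Fin k → Fin D → E) (c : Fin k → Bool) {n : ℕ} [NeZero n]
    (m : {e : E // crosses σ c e = true} → Fin n) : E → Fin n :=
  fun e => if h : crosses σ c e = true then m ⟨e, h⟩ else 0

/-- The row index of the labelling extending `m`: its slot tuples at the vertices with `c v = true`.
[cite: ChristandlVranaZuiddam2016, Ex. 1.1.21] -/
def cutRow (σ : Fin k → Fin D → E) (c : Fin k → Bool) {n : ℕ} [NeZero n]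
    (m : {e : E // crosses σ c e = true} → Fin n) : {v : Fin k // c v = true} → Fin (n ^ D) :=
  fun v => slotIndex σ (extendLabel σ c m) v.1

/-- The column index of the labelling extending `m`: its slot tuples at the vertices with `c v = false`.
[cite: ChristandlVranaZuiddam2016, Ex. 1.1.21] -/
def cutCol (σ : Fin k → Fin D → E) (c : Fin k → Bool) {n : ℕ} [NeZero n]
    (m : {e : E // crosses σ c e = true} → Fin n) : {v : Fin k // c v = false} → Fin (n ^ D) :=
  fun v => slotIndex σ (extendLabel σ c m) v.1

omit [Fintype E] in
/-- Merging the row and column indices of the extended labelling gives back its slot tuples.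
[cite: ChristandlVranaZuiddam2016, Ex. 1.1.21] -/
theorem cutMerge_cutRow_cutCol (σ : Fin k → Fin D → E) (c : Fin k → Bool) {n : ℕ} [NeZero n]
    (m : {e : E // crosses σ c e = true} → Fin n) :
    cutMerge c (cutRow σ c m) (cutCol σ c m) = slotIndex σ (extendLabel σ c m) := by
  funext v
  by_cases h : c v = true
  · rw [cutMerge_of_true c _ _ v h]; rfl
  · rw [cutMerge_of_false c _ _ v (Bool.eq_false_iff.mpr h)]; rfl

/-- The diagonal entries: the row of `m` is `1` at the column of `m` (no empty edge).
[cite: ChristandlVranaZuiddam2016, Ex. 1.1.21] -/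
theorem cutSlice_graphTensor_self {σ : Fin k → Fin D → E} (hσ : ∀ e, ∃ v j, σ v j = e) (c : Fin k → Bool)
    {n : ℕ} [NeZero n] (m : {e : E // crosses σ c e = true} → Fin n) :
    cutSlice c (graphTensor F σ n) (cutRow σ c m) (cutCol σ c m) = 1 := by
  simp only [cutSlice]
  rw [cutMerge_cutRow_cutCol]
  exact graphTensor_apply_slotIndex hσ _

/-- The off-diagonal entries vanish: if the row of `m'` is non-zero at the column of `m`, then `m' = m` — a
labelling with the row slots of `m'` and the column slots of `m` gives every crossing edge both labels.
[cite: ChristandlVranaZuiddam2016, Ex. 1.1.21] -/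
theorem cutSlice_graphTensor_of_ne {σ : Fin k → Fin D → E} (hσ : ∀ e, ∃ v j, σ v j = e) (c : Fin k → Bool)
    {n : ℕ} [NeZero n] {m m' : {e : E // crosses σ c e = true} → Fin n} (hne : m' ≠ m) :
    cutSlice c (graphTensor F σ n) (cutRow σ c m') (cutCol σ c m) = 0 := by
  classical
  simp only [cutSlice]
  rw [graphTensor_apply_of_covering hσ, if_neg]
  rintro ⟨l, hl⟩
  apply hne
  funext e
  obtain ⟨⟨v, j, hv, hvj⟩, ⟨w, j', hw, hwj⟩⟩ := (crosses_iff σ c e.1).1 e.2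
  -- the row slot at `v` says `l e = m' e`, the column slot at `w` says `l e = m e`
  have hrow : slotIndex σ l v = cutRow σ c m' ⟨v, hv⟩ := by
    rw [← cutMerge_of_true c (cutRow σ c m') (cutCol σ c m) v hv]; exact congrFun hl v
  have hcol : slotIndex σ l w = cutCol σ c m ⟨w, hw⟩ := by
    rw [← cutMerge_of_false c (cutRow σ c m') (cutCol σ c m) w hw]; exact congrFun hl w
  simp only [cutRow, cutCol, slotIndex, Equiv.apply_eq_iff_eq] at hrow hcol
  have h1 := congrFun hrow j
  have h2 := congrFun hcol j'
  simp only [hvj, hwj, extendLabel, e.2, dite_true] at h1 h2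
  rw [← h1, ← h2]

/-- **The rows of the flattening of `T_n(G)` indexed by the labellings of the crossing edges are linearly
independent** (no empty edge, `n ≥ 1`). [cite: ChristandlVranaZuiddam2016, Ex. 1.1.21] -/
theorem linearIndependent_cutSlice_graphTensor {σ : Fin k → Fin D → E} (hσ : ∀ e, ∃ v j, σ v j = e)
    (c : Fin k → Bool) (n : ℕ) [NeZero n] :
    LinearIndependent F fun m : {e : E // crosses σ c e = true} → Fin n =>
      cutSlice c (graphTensor F σ n) (cutRow σ c m) := by
  classical
  rw [Fintype.linearIndependent_iff]
  intro g hg m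
  have h := congrFun hg (cutCol σ c m)
  rw [Finset.sum_apply, Pi.zero_apply, Fintype.sum_eq_single m] at h
  · simpa [cutSlice_graphTensor_self hσ c m] using h
  · intro m' hne
    simp [cutSlice_graphTensor_of_ne hσ c hne]

/-- **CVZ19 Ex. 1.1.21 at level `n`: `n ^ #{crossing edges} ≤ R(T_n(G))`** for every vertex cut (no empty edge,
`n ≥ 1`) — "flattening along the appropriate cuts yields `2^{f(G)} ≤ R(T(G))`".
[cite: ChristandlVranaZuiddam2016, Ex. 1.1.21] -/
theorem pow_card_crossing_le_tensorRankD_graphTensor {σ : Fin k → Fin D → E} (hσ : ∀ e, ∃ v j, σ v j = e)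
    (c : Fin k → Bool) (n : ℕ) [NeZero n] :
    n ^ Fintype.card {e : E // crosses σ c e = true} ≤ tensorRankD (graphTensor F σ n) := by
  classical
  have h := card_le_tensorRankD_of_linearIndependent_cutSlice c (graphTensor F σ n)
    (graphTensor_decomposable σ n) _ (linearIndependent_cutSlice_graphTensor (F := F) hσ c n)
  rwa [Fintype.card_fun, Fintype.card_fin] at h

/-- Every admissible exponent of `T(G)` is at least the number of edges crossing any vertex cut.
[cite: ChristandlVranaZuiddam2016, Ex. 1.1.21] -/
theorem card_crossing_le_of_mem_graphExponents {σ : Fin k → Fin D → E} (hσ : ∀ e, ∃ v j, σ v j = e)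
    (c : Fin k → Bool) {β : ℝ} (hβ : β ∈ graphExponents F σ) :
    (Fintype.card {e : E // crosses σ c e = true} : ℝ) ≤ β := by
  set q := Fintype.card {e : E // crosses σ c e = true} with hq
  by_contra hlt
  rw [not_le] at hlt
  obtain ⟨C, hC⟩ := isBigO_iff.1 hβ
  have hev : ∀ᶠ n : ℕ in atTop, (n : ℝ) ^ ((q : ℝ) - β) ≤ C := by
    filter_upwards [hC, eventually_gt_atTop 0] with n hn hn0
    haveI : NeZero n := ⟨hn0.ne'⟩
    have hn0' : (0 : ℝ) < n := Nat.cast_pos.2 hn0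
    rw [Real.norm_of_nonneg (Nat.cast_nonneg _),
      Real.norm_of_nonneg (Real.rpow_nonneg (Nat.cast_nonneg _) _)] at hn
    have hq' : (n : ℝ) ^ (q : ℝ) ≤ C * (n : ℝ) ^ β := by
      refine le_trans ?_ hn
      rw [Real.rpow_natCast]
      exact_mod_cast pow_card_crossing_le_tensorRankD_graphTensor (F := F) hσ c n
    rw [Real.rpow_sub hn0', div_le_iff₀ (Real.rpow_pos_of_pos hn0' _)]
    exact hq'
  have hlim : Tendsto (fun n : ℕ => (n : ℝ) ^ ((q : ℝ) - β)) atTop atTop :=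
    (tendsto_rpow_atTop (by linarith)).comp tendsto_natCast_atTop_atTop
  obtain ⟨n, hn₁, hn₂⟩ := (hev.and (hlim.eventually_gt_atTop C)).exists
  exact absurd hn₁ (not_le.2 hn₂)

/-- **CVZ19 Ex. 1.1.21: `#{crossing edges} ≤ ω(T(G))`** for every vertex cut (no empty edge) — with the max-cut
this is "`f(G) ≤ ω(T(G))`". [cite: ChristandlVranaZuiddam2016, Ex. 1.1.21] -/
theorem card_crossing_le_graphOmega {σ : Fin k → Fin D → E} (hσ : ∀ e, ∃ v j, σ v j = e) (c : Fin k → Bool) :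
    (Fintype.card {e : E // crosses σ c e = true} : ℝ) ≤ graphOmega F σ :=
  le_csInf (graphExponents_nonempty σ) fun _ hβ => card_crossing_le_of_mem_graphExponents hσ c hβ

end Cut

/-! ## §3. Even cycles and the tetrahedron (CVZ19 Thm. 1.1.24, §1.2 table) -/

section Instances

variable (F : Type*) [Field F]

/-- The parity cut of `C_k`. [cite: ChristandlVranaZuiddam2016, Ex. 1.1.21] -/
def parityCut (k : ℕ) : Fin k → Bool :=
  fun v => decide (v.val % 2 = 0)

/-- For even `k`, EVERY edge of `C_k` crosses the parity cut (edge `e` is read by the vertices `e` and `e + 1`,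
of different parities). [cite: ChristandlVranaZuiddam2016, Thm. 1.1.24] -/
theorem crosses_cycleSlots_parityCut {k : ℕ} [NeZero k] (hk : Even k) (e : Fin k) :
    crosses (cycleSlots k) (parityCut k) e = true := by
  rw [crosses_iff]
  -- vertex `e` reads `e` in slot `0`, vertex `e + 1` reads `(e + 1) - 1 = e` in slot `1`
  have h0 : cycleSlots k e 0 = e := by simp [cycleSlots]
  have h1 : cycleSlots k (e + 1) 1 = e := by simp [cycleSlots]
  have hk2 : k % 2 = 0 := Nat.even_iff.mp hk
  have h1k : 1 < k := by
    have := NeZero.pos k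
    omega
  have hval : (e + 1 : Fin k).val = (e.val + 1) % k := by
    rw [Fin.val_add, Fin.val_one', Nat.mod_eq_of_lt h1k]
  have hpar : (e + 1 : Fin k).val % 2 ≠ e.val % 2 := by
    rw [hval]
    by_cases hlast : e.val + 1 < k
    · rw [Nat.mod_eq_of_lt hlast]
      omega
    · have hek : e.val + 1 = k := by
        have := e.isLt
        omega
      rw [hek, Nat.mod_self]
      omega
  by_cases he : e.val % 2 = 0
  · refine ⟨⟨e, 0, ?_, h0⟩, ⟨e + 1, 1, ?_, h1⟩⟩
    · simpa [parityCut] using he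
    · simp only [parityCut, decide_eq_false_iff_not]
      omega
  · refine ⟨⟨e + 1, 1, ?_, h1⟩, ⟨e, 0, ?_, h0⟩⟩
    · simp only [parityCut, decide_eq_true_eq]
      omega
    · simpa [parityCut] using he

/-- For even `k`, the crossing edges of the parity cut of `C_k` are all `k` edges.
[cite: ChristandlVranaZuiddam2016, Thm. 1.1.24] -/
theorem card_crossing_cycleSlots_parityCut {k : ℕ} [NeZero k] (hk : Even k) :
    Fintype.card {e : Fin k // crosses (cycleSlots k) (parityCut k) e = true} = k := by
  rw [Fintype.card_subtype, Finset.filter_true_of_mem fun e _ => crosses_cycleSlots_parityCut hk e,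
    Finset.card_univ, Fintype.card_fin]

/-- **CVZ19 Thm. 1.1.24, even cycles: `ω(T(C_k)) = k` for even `k ≥ 1`** (over every field): `≤ k` by the trivial
cover, `≥ k` by the flattening along the parity cut, which every edge crosses.
[cite: ChristandlVranaZuiddam2016, Thm. 1.1.24] -/
theorem graphOmega_cycleSlots_of_even {k : ℕ} [NeZero k] (hk : Even k) : graphOmega F (cycleSlots k) = k := by
  refine le_antisymm (graphOmega_cycleSlots_le F k) ?_
  have h := card_crossing_le_graphOmega (F := F) (cycleSlots_covering k) (parityCut k)
  rwa [card_crossing_cycleSlots_parityCut hk] at h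

/-- The even-cycle clause of the named fact `cvz19_thm_1_1_24` holds outright.
[cite: ChristandlVranaZuiddam2016, Thm. 1.1.24] -/
theorem cvz19_thm_1_1_24_even (k : ℕ) [NeZero k] (hk : Even k) : graphOmega ℂ (cycleSlots k) = k :=
  graphOmega_cycleSlots_of_even ℂ hk

/-- The cut `{0, 1} | {2, 3}` of the tetrahedron. [cite: ChristandlVranaZuiddam2016, §1.2 (table)] -/
def tetraCut : Fin 4 → Bool :=
  ![true, true, false, false]

/-- The four edges `02, 03, 12, 13` cross the cut `{0,1} | {2,3}` of `K_4` (`f(K_4) = 4`).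
[cite: ChristandlVranaZuiddam2016, §1.2 (table)] -/
theorem card_crossing_tetraSlots_tetraCut :
    Fintype.card {e : Fin 6 // crosses tetraSlots tetraCut e = true} = 4 := by
  decide

/-- **`4 ≤ ω(T(K_4))`** (flattening along a max-cut; CVZ19 §1.2 table "lower 4"; the Summit proves the same bound
for its `tetra` as `four_le_omegaTetra`). [cite: ChristandlVranaZuiddam2016, §1.2 (table)] -/
theorem four_le_graphOmega_tetraSlots : 4 ≤ graphOmega F tetraSlots := by
  have h := card_crossing_le_graphOmega (F := F) tetraSlots_covering tetraCut
  rw [card_crossing_tetraSlots_tetraCut] at h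
  exact_mod_cast h

end Instances

end Literature.Computability.AlgebraicComplexity

end
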